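import Literature.AlgebraicGeometry.Motives.FaltingsECTateMainTheoremProofs
import Literature.NumberTheory.EllipticCurves.IsogenyHomNsmulProofs
import Literature.NumberTheory.EllipticCurves.IsogenyQuotient
import HarnessLib

/-!
# Tate's theorem for elliptic curves over a finite field: the named fact from the named facts

Sibling file of `Literature.AlgebraicGeometry.Motives.FaltingsEC` (D-0014). The proof of Tate's
theorem for elliptic curves in `Literature.AlgebraicGeometry.Motives.FaltingsECTateMainTheoremProofs`
takes its geometric inputs as hypotheses spelled out in elementary terms; here they are fed in as
the corresponding **named facts** of the tree, giving the dependency statements the fact graph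
records:

* `Literature.AlgebraicGeometry.Motives.mem_span_range_tateModule_map_of_equivariant_of_finite_of_facts`:
  `mem_span_range_tateModule_map_of_equivariant_of_finite W W' ℓ` (Tate, Invent. Math. 2 (1966),
  Main Theorem: `Hom_k(E, E') ⊗ ℤ_ℓ → Hom_Γ(T_ℓ E, T_ℓ E')` is onto, for elliptic curves over a
  finite field `k` and `ℓ ≠ char k`) follows from
  - `WeierstrassCurve.exists_isogeny_ker_eq_and_comp_eq_nsmul W` (quotient isogenies and their
    duals; Silverman, *AEC*, Prop. III.4.12, Rem. III.4.13.2, Thm. III.6.1–6.2),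
  - `WeierstrassCurve.Isogeny.exists_eq_comp_nsmul_of_geomTorsion_le_ker W W'` (*AEC*
    Cor. III.4.11 for `[m]` over `k`), and
  - `Literature.Hodge.isIsogenous_of_finite_iff_exists_tateModule_hom_ne_zero W W' ℓ` (Tate's isogeny
    theorem, Theorem 1(b) of loc. cit., corrected form; used only to produce one isogeny `E → E'`).
* `Literature.AlgebraicGeometry.Motives.mem_span_range_tateModule_map_of_equivariant_of_finite_of_facts_of_isIsogenous`:
  for isogenous `E, E'` the first two facts suffice (no isogeny theorem), and
  `Literature.AlgebraicGeometry.Motives.mem_span_range_tateModule_map_of_equivariant_of_finite_end_of_facts`: `E' = E`.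
* `Literature.AlgebraicGeometry.Motives.mem_span_range_tateEndRingHom_iff_of_finite_of_facts`: the `End` form
  `mem_span_range_tateEndRingHom_iff_of_finite W ℓ` of `FaltingsEC` (`ℤ_ℓ · End_k(E) = End_Γ(T_ℓ E)`)
  from the same two facts (`mem_span_range_tateEndRingHom_iff_of_finite_of_quot`).

## References

* [Tate1966Endomorphisms] J. Tate, *Endomorphisms of abelian varieties over finite fields*,
  Invent. Math. 2 (1966), 134–144, Main Theorem, Theorem 1.
* [SilvermanAEC2009] J. H. Silverman, *The Arithmetic of Elliptic Curves*, 2nd ed., GTM 106,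
  III.4.11–4.13, III.6.1–6.2, III.7.7(a).
-/

noncomputable section

universe u

namespace Literature.AlgebraicGeometry.Motives

open WeierstrassCurve

variable {K : Type u} [Field K] (W W' : WeierstrassCurve K) (ℓ : ℕ) [Fact ℓ.Prime]

/-- **Tate's theorem for elliptic curves over a finite field, from the named facts** (module
docstring): quotient isogenies of `E` (*AEC* III.4.12–4.13, III.6.1–6.2), *AEC* Cor. III.4.11
for `(E, E')` over `k`, and Tate's isogeny theorem for `(E, E')` imply the named fact
`mem_span_range_tateModule_map_of_equivariant_of_finite W W' ℓ` (Tate 1966, Main Theorem).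
[cite: Tate1966Endomorphisms, Main Theorem] -/
theorem mem_span_range_tateModule_map_of_equivariant_of_finite_of_facts
    (hquot : W.exists_isogeny_ker_eq_and_comp_eq_nsmul)
    (h411 : Isogeny.exists_eq_comp_nsmul_of_geomTorsion_le_ker W W')
    (hisog : isIsogenous_of_finite_iff_exists_tateModule_hom_ne_zero W W' ℓ) :
    mem_span_range_tateModule_map_of_equivariant_of_finite W W' ℓ := by
  intro _ _ _ hℓ f hf
  exact mem_span_range_tateModule_map_of_equivariant_of_finite_of_quot ℓ
    (fun S hS hst ↦ hquot S hS hst) h411 hisog hℓ f hf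

/-- **Tate's theorem for two isogenous elliptic curves over a finite field, from the named facts**:
if `E, E'` are isogenous over `k`, the named fact
`mem_span_range_tateModule_map_of_equivariant_of_finite W W' ℓ` follows from quotient isogenies of
`E` (*AEC* III.4.12–4.13, III.6.1–6.2) and *AEC* Cor. III.4.11 for `(E, E')` over `k`; no isogeny
theorem is needed. [cite: Tate1966Endomorphisms, Main Theorem] -/
theorem mem_span_range_tateModule_map_of_equivariant_of_finite_of_facts_of_isIsogenous
    (hquot : W.exists_isogeny_ker_eq_and_comp_eq_nsmul)
    (h411 : Isogeny.exists_eq_comp_nsmul_of_geomTorsion_le_ker W W') (hiso : W.IsIsogenous W') :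
    mem_span_range_tateModule_map_of_equivariant_of_finite W W' ℓ := by
  intro _ _ _ hℓ f hf
  exact mem_span_range_tateModule_map_of_equivariant_of_finite_of_quot_of_isIsogenous ℓ
    (fun S hS hst ↦ hquot S hS hst) h411 hiso hℓ f hf

/-- **Tate's theorem for `End_k(E)` over a finite field, from the named facts**: for `E' = E`
the named fact `mem_span_range_tateModule_map_of_equivariant_of_finite W W ℓ` follows from quotient
isogenies of `E` (*AEC* III.4.12–4.13, III.6.1–6.2) and *AEC* Cor. III.4.11 over `k` alone.
[cite: Tate1966Endomorphisms, Main Theorem] -/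
theorem mem_span_range_tateModule_map_of_equivariant_of_finite_end_of_facts
    (hquot : W.exists_isogeny_ker_eq_and_comp_eq_nsmul)
    (h411 : Isogeny.exists_eq_comp_nsmul_of_geomTorsion_le_ker W W) :
    mem_span_range_tateModule_map_of_equivariant_of_finite W W ℓ := by
  intro _ _ _ hℓ f hf
  exact mem_span_range_tateModule_map_of_equivariant_of_finite_end_of_quot ℓ
    (fun S hS hst ↦ hquot S hS hst) h411 hℓ f hf

/-- **Tate's theorem, `End` form, from the named facts**: the named fact
`mem_span_range_tateEndRingHom_iff_of_finite W ℓ` of `FaltingsEC` — a `ℤ_ℓ`-linear endomorphism of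
`T_ℓ E` lies in `ℤ_ℓ · End_k(E)` iff it commutes with `Γ_k`, for `E` elliptic over a finite field
`k` and `ℓ ≠ char k` — follows from quotient isogenies of `E` (*AEC* III.4.12–4.13, III.6.1–6.2)
and *AEC* Cor. III.4.11 over `k`: the reverse implication is
`mem_span_range_tateModule_map_of_equivariant_of_finite_end_of_facts` (an isogeny `E → E` over `k`
is an element of `End_k(E)`, `Isogeny.toAddMonoidHom_mem_endRing`), the forward one the
elementary `smul_of_mem_span_range_tateEndRingHom`. Tate, Invent. Math. 2 (1966), Main Theorem;
Silverman, *AEC*, III.7.7(a). [cite: Tate1966Endomorphisms, Main Theorem] -/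
theorem mem_span_range_tateEndRingHom_iff_of_finite_of_facts
    (hquot : W.exists_isogeny_ker_eq_and_comp_eq_nsmul)
    (h411 : Isogeny.exists_eq_comp_nsmul_of_geomTorsion_le_ker W W) :
    mem_span_range_tateEndRingHom_iff_of_finite W ℓ := by
  intro _ _ hℓ g
  exact mem_span_range_tateEndRingHom_iff_of_finite_of_quot ℓ (fun S hS hst ↦ hquot S hS hst) h411
    hℓ g

/-! ## With *AEC* Cor. III.4.11 discharged (appended)

`Literature.NumberTheory.EllipticCurves.IsogenyHomNsmulProofs` proves the named fact
`Isogeny.exists_eq_comp_nsmul_of_geomTorsion_le_ker` (*AEC* Cor. III.4.11 for `[m]`: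
`WeierstrassCurve.Isogeny.exists_eq_comp_nsmul_of_geomTorsion_le_ker_holds`). Feeding it into the
corollaries above leaves, as inputs of Tate's theorem for elliptic curves over a finite field,
only the quotient-isogeny fact `WeierstrassCurve.exists_isogeny_ker_eq_and_comp_eq_nsmul`
(*AEC* III.4.12–4.13, III.6.1–6.2) and — for a pair `(E, E')` not known to be isogenous — Tate's
isogeny theorem `isIsogenous_of_finite_iff_exists_tateModule_hom_ne_zero W W' ℓ`; for `E' = E`,
for isogenous pairs and for the `End` form, the quotient-isogeny fact alone. -/

/-- **Tate's theorem for elliptic curves over a finite field from quotient isogenies and the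
isogeny theorem** (Cor. III.4.11 being proved, `IsogenyHomNsmulProofs`): the named fact
`mem_span_range_tateModule_map_of_equivariant_of_finite W W' ℓ` (Tate 1966, Main Theorem) follows
from `W.exists_isogeny_ker_eq_and_comp_eq_nsmul` (*AEC* III.4.12–4.13, III.6.1–6.2) and
`isIsogenous_of_finite_iff_exists_tateModule_hom_ne_zero W W' ℓ` (Tate 1966, Thm. 1(b)).
[cite: Tate1966Endomorphisms, Main Theorem] -/
theorem mem_span_range_tateModule_map_of_equivariant_of_finite_of_quot_fact
    (hquot : W.exists_isogeny_ker_eq_and_comp_eq_nsmul)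
    (hisog : isIsogenous_of_finite_iff_exists_tateModule_hom_ne_zero W W' ℓ) :
    mem_span_range_tateModule_map_of_equivariant_of_finite W W' ℓ :=
  mem_span_range_tateModule_map_of_equivariant_of_finite_of_facts W W' ℓ hquot
    (Isogeny.exists_eq_comp_nsmul_of_geomTorsion_le_ker_holds W W') hisog

/-- **Tate's theorem for two isogenous elliptic curves over a finite field from quotient
isogenies alone** (Cor. III.4.11 being proved): for `E ~_k E'`, the named fact
`mem_span_range_tateModule_map_of_equivariant_of_finite W W' ℓ` follows from
`W.exists_isogeny_ker_eq_and_comp_eq_nsmul`. [cite: Tate1966Endomorphisms, Main Theorem] -/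
theorem mem_span_range_tateModule_map_of_equivariant_of_finite_of_quot_fact_of_isIsogenous
    (hquot : W.exists_isogeny_ker_eq_and_comp_eq_nsmul) (hiso : W.IsIsogenous W') :
    mem_span_range_tateModule_map_of_equivariant_of_finite W W' ℓ :=
  mem_span_range_tateModule_map_of_equivariant_of_finite_of_facts_of_isIsogenous W W' ℓ hquot
    (Isogeny.exists_eq_comp_nsmul_of_geomTorsion_le_ker_holds W W') hiso

/-- **Tate's theorem for `End_k(E)` over a finite field from quotient isogenies alone**
(Cor. III.4.11 being proved): the named fact
`mem_span_range_tateModule_map_of_equivariant_of_finite W W ℓ` follows from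
`W.exists_isogeny_ker_eq_and_comp_eq_nsmul`. [cite: Tate1966Endomorphisms, Main Theorem] -/
theorem mem_span_range_tateModule_map_of_equivariant_of_finite_end_of_quot_fact
    (hquot : W.exists_isogeny_ker_eq_and_comp_eq_nsmul) :
    mem_span_range_tateModule_map_of_equivariant_of_finite W W ℓ := by
  intro _ _ _ hℓ f hf
  exact mem_span_range_tateModule_map_of_equivariant_of_finite_end_of_facts W ℓ hquot
    (Isogeny.exists_eq_comp_nsmul_of_geomTorsion_le_ker_holds W W) hℓ f hf

/-- **Tate's theorem, `End` form, from quotient isogenies alone** (Cor. III.4.11 being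
proved): the named fact `mem_span_range_tateEndRingHom_iff_of_finite W ℓ` of `FaltingsEC` follows
from `W.exists_isogeny_ker_eq_and_comp_eq_nsmul`. [cite: Tate1966Endomorphisms, Main Theorem] -/
theorem mem_span_range_tateEndRingHom_iff_of_finite_of_quot_fact
    (hquot : W.exists_isogeny_ker_eq_and_comp_eq_nsmul) :
    mem_span_range_tateEndRingHom_iff_of_finite W ℓ :=
  mem_span_range_tateEndRingHom_iff_of_finite_of_facts W ℓ hquot
    (Isogeny.exists_eq_comp_nsmul_of_geomTorsion_le_ker_holds W W)

/-! ## Unconditional: Tate's theorem for `E` with non-scalar Frobenius (appended)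

`FaltingsECTateMainTheoremProofs` (section "Non-scalar Frobenius") proves the `End` case of
Tate's theorem without quotient isogenies when `ρ_ℓ(σ_q)` is not a scalar on `T_ℓ E`, leaving
Cor. III.4.11 over `k` (`h411`) as the only input; since `h411` is proved in the tree
(`IsogenyHomNsmulProofs`), the following instances of the named facts hold outright. -/

/-- **Tate's theorem for `End_k(E)` over a finite field, unconditionally, when the Frobenius
`ρ_ℓ(σ_q) ∈ End(T_ℓ E)` is not a scalar**: the named fact
`mem_span_range_tateModule_map_of_equivariant_of_finite W W ℓ` (Tate 1966, Main Theorem, for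
`E' = E`) holds for every elliptic curve `E` over a finite field `k` with `q` elements such that
`ρ_ℓ(σ_q) ≠ c • 1` for all `c ∈ ℤ_ℓ` (`σ_q x = x ^ q` on `k̄`). No named fact is assumed.
[cite: Tate1966Endomorphisms, Main Theorem] -/
theorem mem_span_range_tateModule_map_of_equivariant_of_finite_end_of_frobenius_ne_smul
    {σ : Field.absoluteGaloisGroup K} (hσ : ∀ x : AlgebraicClosure K, σ • x = x ^ Nat.card K)
    (hns : ∀ c : ℤ_[ℓ], W.galoisRepTate ℓ σ ≠ c • 1) :
    mem_span_range_tateModule_map_of_equivariant_of_finite W W ℓ := by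
  intro _ _ _ hℓ f hf
  exact mem_span_range_tateModule_map_of_equivariant_of_finite_end_of_ne_smul ℓ hσ hns
    (Isogeny.exists_eq_comp_nsmul_of_geomTorsion_le_ker_holds W W) hℓ f hf

/-- **Tate's theorem for two isogenous elliptic curves over a finite field, unconditionally, when
`ρ_ℓ(σ_q)` is not a scalar on `T_ℓ E`.** [cite: Tate1966Endomorphisms, Main Theorem] -/
theorem mem_span_range_tateModule_map_of_equivariant_of_finite_of_frobenius_ne_smul_of_isIsogenous
    {σ : Field.absoluteGaloisGroup K} (hσ : ∀ x : AlgebraicClosure K, σ • x = x ^ Nat.card K)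
    (hns : ∀ c : ℤ_[ℓ], W.galoisRepTate ℓ σ ≠ c • 1) (hiso : W.IsIsogenous W') :
    mem_span_range_tateModule_map_of_equivariant_of_finite W W' ℓ :=
  mem_span_range_tateModule_map_of_equivariant_of_finite_of_ne_smul_of_isIsogenous ℓ hσ hns
    (Isogeny.exists_eq_comp_nsmul_of_geomTorsion_le_ker_holds W W') hiso

/-- **Tate's theorem, `End` form, unconditionally, when `ρ_ℓ(σ_q)` is not a scalar on `T_ℓ E`**:
the named fact `mem_span_range_tateEndRingHom_iff_of_finite W ℓ` of `FaltingsEC` holds — a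
`ℤ_ℓ`-linear endomorphism of `T_ℓ E` lies in `ℤ_ℓ · End_k(E)` iff it commutes with `Γ_k`.
[cite: Tate1966Endomorphisms, Main Theorem] -/
theorem mem_span_range_tateEndRingHom_iff_of_finite_of_frobenius_ne_smul
    {σ : Field.absoluteGaloisGroup K} (hσ : ∀ x : AlgebraicClosure K, σ • x = x ^ Nat.card K)
    (hns : ∀ c : ℤ_[ℓ], W.galoisRepTate ℓ σ ≠ c • 1) :
    mem_span_range_tateEndRingHom_iff_of_finite W ℓ :=
  mem_span_range_tateEndRingHom_iff_of_finite_of_ne_smul ℓ hσ hns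
    (Isogeny.exists_eq_comp_nsmul_of_geomTorsion_le_ker_holds W W)

end Literature.AlgebraicGeometry.Motives
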